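import Summits.BirchSwinnertonDyer.Rank1Residual.X11b.SelmerTorsionControl
import HarnessLib

/-!
# X11b, route R1 — erratum Lemma 2.1: the two `H⁰`-vanishing hypotheses from the socle
# (`M^Γ = 0` as soon as `M` is `𝔪`-primary and `M[𝔪]^Γ = 0`)

HONEST FRAMING (cell `b2b-bsdres`, run/shared/lean/b2b/bsd-rank1-residual/, verbatim in every
file): the goal of the cell is to DELETE the COMBINATION-SHAPED residual classes of the
Birch–Swinnerton-Dyer formula for ALL analytic-rank `≤ 1` elliptic curves over `ℚ` — "full BSD
formula for every rank `≤ 1` curve in class `C`" assembled STRICTLY from published theorems — so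
that the rank-`≤ 1` remainder becomes exactly the CONSTRUCTION-SHAPED classes, which are TYPED
(missing-input `Prop`s), NOT attempted. This is not "finishing BSD". Sub-cell
`b2b-bsdres-multr1-p1` (X11b via the re-proof of Castella 2018 Thm. A along the author's erratum):
a RESEARCH ROUTE; no claim beyond the stated class; X11b stays CONSTRUCTION-SHAPED; nothing here
changes a label; no named fact is introduced (theorems only; no `sorry`).

## What this file kernel-checks

Erratum Lemma 2.1 (`Sel^Σ_𝔭̄(K, M_g[ϖ^m]) ≃ Sel^Σ_𝔭̄(K, M_g)[ϖ^m]`, proof p. 2, verbatim in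
`TorsionCohomologyControl.lean`) is the kernel theorem `TorsionControl.selmerTorsionEquiv`
(`SelmerTorsionControl.lean`, p205298) for abstract Selmer data `(Γ, φ_v : Γ_v → Γ, L)`, under
two hypotheses left there in the erratum's own form:

* (glob) "`H⁰(K, M_g) = H⁰(K_∞, A_g) = 0` by Shapiro's lemma and the irreducibility of
  `ρ̄_g|_{G_K}`" — `M^Γ` is `r`-divisible (e.g. `= 0`);
* (loc) "the kernel of the second arrow is given by `H⁰(K_𝔭̄, M_g)/ϖ^m H⁰(K_𝔭̄, M_g)` and this
  vanishes when so does `H⁰(K_𝔭̄, A_g[ϖ])`" — `M^{Γ_v}` is `r`-divisible for `v ∈ L`.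

Gen 4 reduced each to a statement about the `r`-torsion (`invariants_eq_bot_of_torsionBy`:
`M` `r`-primary and `M[r]^Γ = 0 ⟹ M^Γ = 0`), which for `M_g = T_g ⊗_𝒪 Λ_𝒪^*` (`r = ϖ`) still
refers to the big module `M_g[ϖ] = ρ̄_g ⊗ (Λ_𝒪/ϖ)^*`. This file proves the criterion for an
arbitrary IDEAL `I` of the coefficient ring (`forall_invariant_eq_zero_of_idealTorsion`: if every
element of `M` is killed by a power of `I` and no nonzero element of the socle `M[I]` is
`Γ`-invariant, then `M^Γ = 0`; by induction on the exponent, using only that the action is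
`A`-linear), the passage from two principal primary decompositions to the primary decomposition
for `I ⊔ J` (`idealTorsion_sup`, Mathlib's `Ideal.sup_pow_add_le_pow_sup_pow`), and the resulting
form of Lemma 2.1 with SOCLE hypotheses (`selmerTorsionEquiv_of_socle`). DICTIONARY (erratum §2,
[Cas18, §2.1]): `A = Λ_𝒪 = 𝒪⟦T⟧`, `I = 𝔪 = (ϖ, T) = (ϖ) ⊔ (T)`; `M_g = T_g ⊗_𝒪 Λ_𝒪^*` is
`ϖ`-primary and `T`-primary (every element of `Λ_𝒪^* = Hom_cts(Λ_𝒪, ℚ_p/ℤ_p) = lim→ (Λ_𝒪/𝔪ⁿ)^*`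
is killed by some `𝔪ⁿ`), hence `𝔪`-primary; its socle is `M_g[𝔪] = T_g/ϖ ⊗ Λ_𝒪^*[𝔪] ≅ ρ̄_g`
with `Γ` acting through `ρ̄_g` (`Ψ ≡ 1 mod 𝔪`), i.e. `M_g[𝔪] ≅ A_g[ϖ]` as a Galois module. So:
(glob) ⟸ `H⁰(K, ρ̄_g) = 0` ⟸ `ρ̄_g|_{G_K}` irreducible of dimension `2` (no stable line);
(loc) at `v = 𝔭̄` (`K_𝔭̄ = ℚ_p`) ⟸ `H⁰(ℚ_p, ρ̄_g) = 0`, which for `ρ̄_{g_m} ≃ E[p]` is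
`E(ℚ_p)[p] = 0` — hypothesis (iv) of Thm. 1.1 / Thm. A′, exactly as the erratum says ("the new
hypothesis (2) will be forced on us to show that the Selmer groups … behave well under
congruences", p. 2). What stays INPUT: the objects `M_g`, and the two identifications
`M_g[𝔪] ≅ ρ̄_g`, "`Sel^Σ_𝔭̄ ⊂ H¹(G_{K,S}, ·)`" (dictionary, as in `SelmerTorsionControl.lean`).
CONDITIONAL on nothing; deletes nothing.

References: F. Castella, *Erratum to "On the p-part of the Birch–Swinnerton-Dyer formula for
multiplicative primes"* (web, n.d.), Lemma 2.1 and p. 2 [Castella2018Erratum]; F. Castella,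
Camb. J. Math. 6 (2018) §2.1 (`M_f = T ⊗ Λ^*`, `Ψ⁻¹`-twisted) [Castella2018].
-/

noncomputable section

open Literature Literature.NumberTheory.GaloisRepresentations

universe u

namespace Summit.BirchSwinnertonDyer.Rank1Residual.X11b.TorsionControl

variable {A : Type*} [CommRing A] [TopologicalSpace A]
variable {Γ : Type u} [Group Γ] [TopologicalSpace Γ]
variable {M : Type u} [AddCommGroup M] [Module A M] [TopologicalSpace M]

/-! ### `I`-primary modules: vanishing of invariants from the socle `M[I]` -/

section Socle

variable (ρ : ContinuousRep Γ A M) (I : Ideal A)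

/-- **Socle criterion.** Let `Γ` act `A`-linearly on `M`, and let `I` be an ideal of `A` such that
every element of `M` is killed by some power of `I` (`M` is `I`-primary; e.g. `M_g` and
`𝔪 = (ϖ, T)`). If no nonzero element of the socle `M[I] = {m | I·m = 0}` is `Γ`-invariant, then
`M` has no nonzero `Γ`-invariant. Proof by induction on the exponent `n` with `Iⁿ·m = 0`: for an
invariant `m` and `a ∈ I`, `a·m` is invariant (linearity) and killed by `Iⁿ⁻¹`, hence zero by
induction; so `m ∈ M[I]^Γ = 0`. Generalises `forall_invariant_eq_zero_of_torsionBy` (`I = (r)`).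
[folklore] -/
theorem forall_invariant_eq_zero_of_idealTorsion
    (hprim : ∀ m : M, ∃ n : ℕ, ∀ a ∈ I ^ n, a • m = 0)
    (h0 : ∀ m : M, (∀ a ∈ I, a • m = 0) → (∀ g : Γ, ρ g m = m) → m = 0) :
    ∀ m : M, (∀ g : Γ, ρ g m = m) → m = 0 := by
  -- strengthen to: for every `n`, every invariant `m` killed by `I ^ n` vanishes
  suffices key : ∀ n : ℕ, ∀ m : M, (∀ a ∈ I ^ n, a • m = 0) → (∀ g : Γ, ρ g m = m) → m = 0 by
    intro m hm
    obtain ⟨n, hn⟩ := hprim m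
    exact key n m hn hm
  intro n
  induction n with
  | zero =>
    intro m hn _
    simpa using hn 1 (by simp)
  | succ n ih =>
    intro m hn hm
    refine h0 m (fun a ha => ?_) hm
    -- `a • m` is invariant and killed by `I ^ n`
    refine ih (a • m) (fun b hb => ?_) (fun g => by rw [map_smul, hm g])
    rw [smul_smul]
    exact hn (b * a) (by rw [pow_succ]; exact Ideal.mul_mem_mul hb ha)

variable [DiscreteTopology M] [ContinuousSMul A M]

/-- The socle criterion with the conclusion `M^Γ = ⊥` (invariants of the attached topological
representation). [folklore] -/
theorem invariants_eq_bot_of_idealTorsion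
    (hprim : ∀ m : M, ∃ n : ℕ, ∀ a ∈ I ^ n, a • m = 0)
    (h0 : ∀ m : M, (∀ a ∈ I, a • m = 0) → (∀ g : Γ, ρ g m = m) → m = 0) :
    ρ.toTopRep.ρ.invariants = ⊥ :=
  (Submodule.eq_bot_iff _).2 fun m hm =>
    forall_invariant_eq_zero_of_idealTorsion ρ I hprim h0 m fun g => hm g

end Socle

/-! ### Primary for `I` and for `J` ⟹ primary for `I ⊔ J` (e.g. `(ϖ) ⊔ (T) = 𝔪`) -/

section Primary

omit [TopologicalSpace A] [TopologicalSpace M] in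
/-- If every element of `M` is killed by a power of `I` and by a power of `J`, it is killed by a
power of `I ⊔ J` (`(I ⊔ J)^{a+b} ≤ I^a ⊔ J^b`, Mathlib `Ideal.sup_pow_add_le_pow_sup_pow`). For
`M_g`: `ϖ`-primary and `T`-primary ⟹ `𝔪`-primary, `𝔪 = (ϖ, T)`. [folklore] -/
theorem idealTorsion_sup (I J : Ideal A)
    (hI : ∀ m : M, ∃ n : ℕ, ∀ a ∈ I ^ n, a • m = 0)
    (hJ : ∀ m : M, ∃ n : ℕ, ∀ a ∈ J ^ n, a • m = 0) :
    ∀ m : M, ∃ n : ℕ, ∀ a ∈ (I ⊔ J) ^ n, a • m = 0 := by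
  intro m
  obtain ⟨a, ha⟩ := hI m
  obtain ⟨b, hb⟩ := hJ m
  refine ⟨a + b, fun x hx => ?_⟩
  have hx' : x ∈ I ^ a ⊔ J ^ b := Ideal.sup_pow_add_le_pow_sup_pow hx
  obtain ⟨y, hy, z, hz, rfl⟩ := Submodule.mem_sup.1 hx'
  rw [add_smul, ha y hy, hb z hz, add_zero]

omit [TopologicalSpace A] [TopologicalSpace M] in
/-- The principal case as used in gen 4: "every `m` is killed by a power of `r`" is
`(r)`-primarity in the ideal sense. [folklore] -/
theorem idealTorsion_span_singleton_of_pow_smul {r : A}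
    (h : ∀ m : M, ∃ n : ℕ, r ^ n • m = 0) :
    ∀ m : M, ∃ n : ℕ, ∀ a ∈ (Ideal.span {r}) ^ n, a • m = 0 := by
  intro m
  obtain ⟨n, hn⟩ := h m
  refine ⟨n, fun a ha => ?_⟩
  rw [Ideal.span_singleton_pow, Ideal.mem_span_singleton] at ha
  obtain ⟨c, rfl⟩ := ha
  rw [mul_comm, mul_smul, hn, smul_zero]

omit [TopologicalSpace A] [TopologicalSpace M] in
/-- Conversely the socle for `(r)` is the `r`-torsion: `(∀ a ∈ (r), a • m = 0) ↔ r • m = 0`.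
[folklore] -/
theorem forall_mem_span_singleton_smul_eq_zero_iff {r : A} {m : M} :
    (∀ a ∈ Ideal.span {r}, a • m = 0) ↔ r • m = 0 := by
  constructor
  · exact fun h => h r (Ideal.mem_span_singleton_self r)
  · intro h a ha
    obtain ⟨c, rfl⟩ := Ideal.mem_span_singleton'.1 ha
    rw [mul_smul, h, smul_zero]

omit [TopologicalSpace A] [TopologicalSpace M] in
/-- The socle for `(r) ⊔ (s)` is the joint torsion `M[r] ∩ M[s]` (for `M_g` and `𝔪 = (ϖ, T)`:
`M_g[𝔪] = M_g[ϖ][T]`, the module the erratum calls `A_g[ϖ]` up to the identification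
`T_g/ϖ ⊗ Λ^*[𝔪] ≅ ρ̄_g`). [folklore] -/
theorem forall_mem_sup_span_singleton_smul_eq_zero_iff {r s : A} {m : M} :
    (∀ a ∈ Ideal.span {r} ⊔ Ideal.span {s}, a • m = 0) ↔ r • m = 0 ∧ s • m = 0 := by
  constructor
  · intro h
    exact ⟨h r (Ideal.mem_sup_left (Ideal.mem_span_singleton_self r)),
      h s (Ideal.mem_sup_right (Ideal.mem_span_singleton_self s))⟩
  · rintro ⟨hr, hs⟩ a ha
    obtain ⟨y, hy, z, hz, rfl⟩ := Submodule.mem_sup.1 ha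
    rw [add_smul, forall_mem_span_singleton_smul_eq_zero_iff.2 hr y hy,
      forall_mem_span_singleton_smul_eq_zero_iff.2 hs z hz, add_zero]

end Primary

/-! ### Lemma 2.1 with socle hypotheses -/

section Selmer

variable [IsTopologicalGroup Γ]
variable {ι : Type*} {Γv : ι → Type u} [∀ v, Group (Γv v)] [∀ v, TopologicalSpace (Γv v)]
  [∀ v, IsTopologicalGroup (Γv v)]
variable (φ : ∀ v, Γv v →ₜ* Γ) (L : Set ι)
variable [DiscreteTopology M] [ContinuousSMul A M] (ρ : ContinuousRep Γ A M) (r : A) (I : Ideal A)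

/-- **Erratum Lemma 2.1 with its two `H⁰`-hypotheses in SOCLE form.** For Selmer data
`(Γ, φ_v : Γ_v → Γ, L)` (dictionary `G_{K,S}`, `G_{K_𝔭̄}`, `L = {𝔭̄}`), a discrete `A`-linear
`Γ`-module `M` (`M_g`), `r ∈ A` acting surjectively on `M` (`ϖ^m`; `M_g` is divisible) and an
ideal `I` (`𝔪 = (ϖ, T)`) with `M` `I`-primary: if the socle `M[I]` (`≅ ρ̄_g`) has no nonzero
`Γ`-invariant ("irreducibility of `ρ̄_g|_{G_K}`") and no nonzero `Γ_v`-invariant for `v ∈ L`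
("`H⁰(K_𝔭̄, A_g[ϖ]) = 0`", i.e. `E(ℚ_p)[p] = 0` for `g_m`), then `H¹(ι)` induces
`Sel(M[r]) ≃ Sel(M)[r]` — `selmerTorsionEquiv` with (glob), (loc) discharged by the socle
criterion. [cite: Castella2018Erratum, Lemma 2.1 (p. 2)] -/
def selmerTorsionEquiv_of_socle (hr : Function.Surjective fun m : M => r • m)
    (hprim : ∀ m : M, ∃ n : ℕ, ∀ a ∈ I ^ n, a • m = 0)
    (hglob : ∀ m : M, (∀ a ∈ I, a • m = 0) → (∀ g : Γ, ρ g m = m) → m = 0)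
    (hloc : ∀ v ∈ L, ∀ m : M, (∀ a ∈ I, a • m = 0) → (∀ h : Γv v, ρ (φ v h) m = m) → m = 0) :
    selmer φ L (torsionRep ρ r) ≃ₗ[A] Submodule.torsionBy A (selmer φ L ρ) r :=
  selmerTorsionEquiv φ L ρ r hr
    (invariants_divisible_of_eq_bot ρ r (invariants_eq_bot_of_idealTorsion ρ I hprim hglob))
    (fun v hv => invariants_divisible_of_eq_bot (ρ.restrict (φ v)) r
      (invariants_eq_bot_of_idealTorsion (ρ.restrict (φ v)) I hprim
        (fun m hI hfix => hloc v hv m hI (fun h => by simpa using hfix h))))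

/-- Unfolding: the underlying map of `selmerTorsionEquiv_of_socle` is `H¹(ι)`. [folklore] -/
@[simp] theorem selmerTorsionEquiv_of_socle_apply_coe_coe (hr : Function.Surjective fun m : M => r • m)
    (hprim : ∀ m : M, ∃ n : ℕ, ∀ a ∈ I ^ n, a • m = 0)
    (hglob : ∀ m : M, (∀ a ∈ I, a • m = 0) → (∀ g : Γ, ρ g m = m) → m = 0)
    (hloc : ∀ v ∈ L, ∀ m : M, (∀ a ∈ I, a • m = 0) → (∀ h : Γv v, ρ (φ v h) m = m) → m = 0)
    (x : selmer φ L (torsionRep ρ r)) :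
    (((selmerTorsionEquiv_of_socle φ L ρ r I hr hprim hglob hloc x :
        Submodule.torsionBy A (selmer φ L ρ) r) : selmer φ L ρ) : continuousCohomology 1 ρ.toTopRep)
      = torsionInclH1 ρ r x := by
  simp [selmerTorsionEquiv_of_socle]

end Selmer

end Summit.BirchSwinnertonDyer.Rank1Residual.X11b.TorsionControl

end
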